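import Summits.HodgeConjecture.Ring2.RowFourClosed
import Summits.HodgeConjecture.HodgeConjecture.Theorems.Ring2AbelianAllTypeIIIFourfoldsPrint
import Literature.AlgebraicGeometry.HodgeTheory.AbelianLowDimensionNoncommutativeFourfolds
import HarnessLib

/-!
# Ring 2 (cell topic `Summits/HodgeConjecture/Ring2/`; seat `lit`, gen 75, R52 §4): the named fact `MoonenZarhin1999_simpleFourfold_noncommutative_divisorGenerated_or_quaternion` (Moonen–Zarhin 1999 Thm. 0.1 read for simple fourfolds with non-commutative endomorphism ring) HOLDS

HONEST FRAMING (cell `pub-hodge-ring2`, verbatim): research route conditional on HC_CM; not a corollary;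
Q11.4-sentence-2 already refuted in dim ≥ 3. `HC_CM` does NOT occur in this file; Markman's theorem does not occur;
Floccari–Fu 2026 Thm. 1.2 is a HYPOTHESIS of the one corollary of §3. Theorems only — no definition, no named fact, no
`sorry`; NET effect on the Literature debt `−1`.

THE PRINT. B. Moonen, Yu. Zarhin, Math. Ann. **315** (1999) Thm. 0.1: for `dim X ≤ 4`, outside the cases (a) `X ∼ X₁ × X₂`
with `X₁` a CM elliptic curve, (b) `X` simple, `End⁰(X)` a field `⊇ k` acting with multiplicities `(2,2)`, (c) `X` simple,
`End⁰(X)` a definite quaternion algebra over `ℚ`, (d) `End⁰(X) = ℚ`: «(4) … `Hg(X) = Sp_D(V,φ)` and `B•(Xⁿ) = D•(Xⁿ)`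
for all `n`»; the classification behind it (§2 (2.2): for a simple fourfold with non-commutative `End⁰`: type II(1), II(2)
or III(1)) is Albert's table with Shimura 1963 Thm. 5 — type III(2) («`m = 1`») and type IV with `d = 2` («(5)») do not
occur.

THIS FILE. `AbelianLowDimensionNoncommutativeFourfolds.MoonenZarhin1999_simpleFourfold_noncommutative_divisorGenerated_or_quaternion`
(«a simple fourfold with non-commutative endomorphism ring has `B•(Xⁿ) = D•(Xⁿ)` for all `n`, or carries anticommuting
`φ, ψ ∈ End X` with `φ² = -d`, `ψ² = -e`») is PROVED from the tree: by Albert's arithmetic (`RowFourClosed.sq_mul_dvd_eight`)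
and Shimura's case (5) (`RowFourClosed.hasNoTypeIVFactor_of_isSimple_of_finrank_eq_eight`, lit gen 75) a simple fourfold
with non-commutative `End⁰` is II(1) [`IsTotallyIndefinite ℚ`: all powers divisor-generated, the tree's
`AbelianVariety.isDivisorGenerated_powSucc_of_fourfold_typeII_rat`, Moonen–Zarhin 1995 / Chi], III(1) [definite over `ℚ`:
integral anticommuting generators, §1, as in the Literature lane's `DefiniteQuaternionFourfoldHodgeClasses` §4], or a
quaternion algebra over a REAL quadratic field with `dim = 2[K:ℚ]` [all powers divisor-generated, the tree's
`AbelianVariety.isDivisorGenerated_powSucc_of_isSimple_quaternion_of_dim_eq`, Banaszak–Gajda–Krasoń / Murty; type III(2)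
excluded by Shimura inside that theorem].
* §1 `exists_anticommuting_pair_of_isTotallyDefinite_rat` — integral anticommuting generators of a definite quaternion
  `End⁰(X)` over `ℚ` (`End⁰ ≃ ℍ[ℚ,a,b]`, `a,b < 0`; clear denominators in `End⁰ = ℚ ⊗ End`).
* §2 **`moonenZarhin1999_simpleFourfold_noncommutative_divisorGenerated_or_quaternion_holds`** — THE NAMED FACT HOLDS.
* §3 `hodgeConjectureFor_powSucc_of_simple_noncomm_fourfold_of_floccariFu` — HC for ALL POWERS of EVERY simple complex
  abelian fourfold with non-commutative endomorphism ring, modulo Floccari–Fu 2026 Thm. 1.2 ALONE (the cell's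
  `Ring2AbelianAllTypeIIIFourfoldsPrint.hodgeConjectureFor_powSucc_of_simple_noncomm_fourfold` with `hMZ` discharged);
  `hodgePowersOfTypeIIIFourfold_of_floccariFu`.

## References
* [MoonenZarhin1999LowDim] B. Moonen, Yu. Zarhin, Math. Ann. 315 (1999) 711–733, Thm. 0.1 (cases (a)–(d), part (4)), §2 (2.2).
* [MoonenZarhin1995Duke] B. Moonen, Yu. Zarhin, Duke Math. J. 77 (1995), Type II (cite-only).
* [Shimura1963AnalyticFamilies] G. Shimura, Ann. of Math. 78 (1963), Thm. 5 (cases (1), (5)).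
* [MumfordAV1970] D. Mumford, *Abelian Varieties* (1970), §19 Thm. 3, Cor. 2; §21.
* [FloccariFu2026] S. Floccari, L. Fu, Thm. 1.2 (hypothesis of §3 only).
* [vanGeemen1994HodgeAV] B. van Geemen, LNM 1594 (1994), 2.4–2.5.
-/

noncomputable section

open CategoryTheory CategoryTheory.Limits
open scoped TensorProduct

namespace Summit.HodgeConjecture.Ring2.NoncommutativeFourfoldsFactHolds

open Literature.AlgebraicGeometry.Motives (AbelianVariety bettiCohomology HodgeTensorFacts IsSmoothProjective)
open Literature.AlgebraicGeometry.Motives.AbelianVariety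
open Literature.AlgebraicGeometry.HodgeTheory
open Literature.AlgebraicGeometry.ComplexMultiplication
open Literature.AlgebraicGeometry.Milne1999
open NumberField
open Literature.NumberTheory.Automorphic (IsQuaternionAlgebra IsTotallyDefinite)
open Literature.RingTheory.CentralSimple
open Summit.HodgeConjecture.HodgeConjecture.Ring2.ClassTargets
open Summit.HodgeConjecture.Ring2.RowFourClosed
open Summit.HodgeConjecture.HodgeConjecture.Ring2.AbelianAll

variable {A : AbelianVariety ℂ}

/-! ### §1 Integral anticommuting generators of a definite quaternion algebra over `ℚ` -/

/-- **Integral anticommuting generators.** If `End⁰(X)` is a totally definite quaternion algebra over `ℚ` then there are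
`φ, ψ ∈ End(X)` and integers `d, e ≥ 1` with `φ² = -d`, `ψ² = -e`, `φψ = -ψφ`: `End⁰(X) ≃ ℍ[ℚ,a,b]` with `a, b < 0`
(the tree's `exists_algEquiv_quaternionAlgebra_totallyNeg_of_isTotallyDefinite`), the standard generators `i, j` rescaled
to square to negative integers and cleared of denominators in `End⁰ = ℚ ⊗ End` (Mumford §19 Thm. 3) — verbatim the
construction of the Literature lane's `AbelianVariety.isCodimTwoDivisorWeilGenerated_of_isTotallyDefinite_quaternion`.
[cite: MumfordAV1970, §19 Thm. 3 and §21 (type III)] [cite: MoonenZarhin1999LowDim, Thm. 0.1 (2) (c)] -/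
theorem exists_anticommuting_pair_of_isTotallyDefinite_rat (X : AbelianVariety ℂ) [IsQuaternionAlgebra ℚ X.endAlgebra]
    (hdef : IsTotallyDefinite ℚ X.endAlgebra) :
    ∃ (φ ψ : X ⟶ X) (d e : ℕ), 0 < d ∧ 0 < e ∧ φ ≫ φ = -(d • 𝟙 X) ∧ ψ ≫ ψ = -(e • 𝟙 X) ∧ φ ≫ ψ = -(ψ ≫ φ) := by
  classical
  obtain ⟨a, b, -, -, hneg, ⟨e⟩⟩ := exists_algEquiv_quaternionAlgebra_totallyNeg_of_isTotallyDefinite ℚ X.endAlgebra hdef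
  have ha0 : a < 0 := by have h : ((a : ℝ)) < 0 := (hneg (Rat.castHom ℝ)).1; exact_mod_cast h
  have hb0 : b < 0 := by have h : ((b : ℝ)) < 0 := (hneg (Rat.castHom ℝ)).2; exact_mod_cast h
  set q : QuaternionAlgebra.Basis X.endAlgebra a 0 b :=
    (QuaternionAlgebra.Basis.self ℚ).compHom (e.symm : QuaternionAlgebra ℚ a 0 b →ₐ[ℚ] X.endAlgebra) with hq
  have hii : q.i * q.i = a • (1 : X.endAlgebra) := by rw [q.i_mul_i, zero_smul, add_zero]
  have hjj : q.j * q.j = b • (1 : X.endAlgebra) := q.j_mul_j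
  have hij : q.i * q.j = -(q.j * q.i) := by rw [q.i_mul_j, q.j_mul_i, zero_smul, zero_sub, neg_neg]
  -- integral generators: rescale to square to negative INTEGERS, then clear denominators in `End⁰ = ℚ ⊗ End`
  have hint : ∀ (r : ℚ) (z : X.endAlgebra), r < 0 → z * z = r • (1 : X.endAlgebra) →
      ∃ (F : CategoryTheory.End X) (d : ℕ) (cF : ℚ), 0 < d ∧ cF ≠ 0 ∧ AbelianVariety.endAlgebra.of X F = cF • z ∧
        F ≫ F = -(d • 𝟙 X) := by
    intro r z hr hz
    set z' : X.endAlgebra := (r.den : ℚ) • z with hz'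
    set t : ℤ := (r.den : ℤ) * r.num with ht
    have hrden : (r.den : ℚ) * r = r.num := by rw [mul_comm]; exact Rat.mul_den_eq_num r
    have hz'sq : z' * z' = (t : ℚ) • (1 : X.endAlgebra) := by
      rw [hz', smul_mul_smul_comm, hz, smul_smul, ht, Int.cast_mul, Int.cast_natCast, mul_assoc, hrden]
    have hnum : r.num < 0 := by
      by_contra hge
      exact absurd (Rat.num_nonneg.1 (not_lt.1 hge)) (not_le.2 hr)
    have ht0 : t < 0 := mul_neg_of_pos_of_neg (Int.natCast_pos.2 r.den_pos) hnum
    obtain ⟨M, F, hM, hF⟩ := AbelianVariety.endAlgebra.exists_eq_algebraMap_mul_of z'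
    have hM0 : (M : ℚ) ≠ 0 := Nat.cast_ne_zero.2 hM
    have hofF : AbelianVariety.endAlgebra.of X F = (M : ℚ) • z' := by
      rw [hF, Algebra.smul_def, ← mul_assoc, ← map_mul, mul_inv_cancel₀ hM0, map_one, one_mul]
    set d : ℕ := M * M * t.natAbs with hd
    have htabs : (t.natAbs : ℤ) = -t := Int.ofNat_natAbs_of_nonpos ht0.le
    have hdpos : 0 < d := Nat.mul_pos (Nat.mul_pos (Nat.pos_of_ne_zero hM) (Nat.pos_of_ne_zero hM))
      (Int.natAbs_pos.2 ht0.ne)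
    have hF2 : AbelianVariety.endAlgebra.of X F * AbelianVariety.endAlgebra.of X F = -((d : ℚ) • (1 : X.endAlgebra)) := by
      rw [hofF, smul_mul_smul_comm, hz'sq, smul_smul, hd, Nat.cast_mul, Nat.cast_mul]
      have htq : ((t.natAbs : ℕ) : ℚ) = -(t : ℚ) := by rw [← Int.cast_natCast (R := ℚ) t.natAbs, htabs, Int.cast_neg]
      have hcoef : ((M : ℚ) * M * (t : ℚ)) = -((M : ℚ) * M * (t.natAbs : ℚ)) := by rw [htq]; ring
      rw [hcoef, Algebra.smul_def, map_neg, neg_mul, ← Algebra.smul_def]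
    have hFF : F * F = -(d • (1 : End X)) := by
      apply AbelianVariety.endAlgebra.of_injective_of_charZero (A := X)
      rw [map_mul, hF2, map_neg, map_nsmul, map_one, Nat.cast_smul_eq_nsmul]
    refine ⟨F, d, (M : ℚ) * r.den, hdpos, mul_ne_zero hM0 (Nat.cast_ne_zero.2 r.den_pos.ne'), ?_, hFF⟩
    rw [hofF, hz', smul_smul]
  obtain ⟨φ₁, d₁, c₁, hd₁, hc₁, hφ₁, h₁⟩ := hint a q.i ha0 hii
  obtain ⟨φ₂, d₂, c₂, hd₂, hc₂, hφ₂, h₂⟩ := hint b q.j hb0 hjj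
  have h₁₂ : φ₁ ≫ φ₂ = -(φ₂ ≫ φ₁) := by
    have hE : φ₂ * φ₁ = -(φ₁ * φ₂) := by
      apply AbelianVariety.endAlgebra.of_injective_of_charZero (A := X)
      rw [map_neg, map_mul, map_mul, hφ₁, hφ₂, smul_mul_smul_comm, smul_mul_smul_comm, hij, mul_comm c₂ c₁, smul_neg,
        neg_neg]
    exact hE
  exact ⟨φ₁, φ₂, d₁, d₂, hd₁, hd₂, h₁, h₂, h₁₂⟩

/-! ### §2 The named fact holds -/

/-- **MOONEN–ZARHIN 1999 Thm. 0.1 FOR SIMPLE FOURFOLDS WITH NON-COMMUTATIVE ENDOMORPHISM RING IS A THEOREM OF THE TREE: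
the named fact `MoonenZarhin1999_simpleFourfold_noncommutative_divisorGenerated_or_quaternion` HOLDS.**  Let `A` be a
simple complex abelian fourfold with `ψ ≫ χ ≠ χ ≫ ψ` for some `ψ, χ ∈ End A`.  Then `End⁰(A)` is non-commutative, so
(`d²e ∣ 8`, `d ≥ 2`) `[End⁰(A):ℚ] ∈ {4, 8}` with centre of degree `1`, resp. `2`: a quaternion algebra over `ℚ` —
indefinite, and then `B•(Aⁿ) = D•(Aⁿ)` for all `n` (Moonen–Zarhin 1995 type II / Chi), or definite, and then §1 gives the
anticommuting integral generators — or a quaternion algebra over a REAL quadratic field with `dim A = 2[K:ℚ]`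
(`RowFourClosed.exists_quaternion_minimal_of_finrank_eq_eight`: the imaginary quadratic centre is Shimura's empty case
(5)), and then `B•(Aⁿ) = D•(Aⁿ)` for all `n` (Banaszak–Gajda–Krasoń / Murty, the tree's
`AbelianVariety.isDivisorGenerated_powSucc_of_isSimple_quaternion_of_dim_eq`, which itself excludes type III(2)).
[cite: MoonenZarhin1999LowDim, Thm. 0.1 (cases (a)–(d) and part (4)), §2 (2.2)] [cite: Shimura1963AnalyticFamilies, Thm. 5]
[cite: MumfordAV1970, §19 Cor. 2 and §21] -/
theorem moonenZarhin1999_simpleFourfold_noncommutative_divisorGenerated_or_quaternion_holds :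
    MoonenZarhin1999_simpleFourfold_noncommutative_divisorGenerated_or_quaternion := by
  intro A hA4 hAs hnc
  have hA0 : 0 < A.dim := by omega
  haveI : Nontrivial A.endAlgebra := nontrivial_endAlgebra_of_dim_pos hA0
  -- `End⁰(A)` is non-commutative
  have hnc' : ∃ x y : A.endAlgebra, x * y ≠ y * x := by
    obtain ⟨ψ, χ, hne⟩ := hnc
    refine ⟨AbelianVariety.endAlgebra.of A χ, AbelianVariety.endAlgebra.of A ψ, fun h => hne ?_⟩
    rw [← map_mul, ← map_mul] at h
    exact AbelianVariety.endAlgebra.of_injective_of_charZero (A := A) h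
  obtain ⟨d, hd, hde, hdvd⟩ := exists_sq_mul_finrank_center_dvd_two_mul_dim hAs hA0
  rw [hA4] at hdvd
  rcases sq_mul_dvd_eight hd hdvd with ⟨rfl, -⟩ | ⟨rfl, he⟩
  · -- `d = 1`: commutative, contradiction
    exfalso
    rw [one_pow, one_mul] at hde
    have htop := center_eq_top_of_finrank_eq hde
    obtain ⟨x, y, hxy⟩ := hnc'
    exact hxy ((Subalgebra.mem_center_iff.1 (show y ∈ Subalgebra.center ℚ A.endAlgebra from htop ▸ Algebra.mem_top) x))
  · rcases he with h | h <;> rw [h] at hde <;> norm_num at hde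
    · -- quaternion algebra over `ℚ`
      haveI hQ : IsQuaternionAlgebra ℚ A.endAlgebra :=
        AbelianVariety.isQuaternionAlgebra_endAlgebra_of_isSimple hAs hA0 hde hnc'
      rcases isTotallyDefinite_or_isTotallyIndefinite_rat A.endAlgebra with hdef | hind
      · exact Or.inr (exists_anticommuting_pair_of_isTotallyDefinite_rat A hdef)
      · exact Or.inl fun N => AbelianVariety.isDivisorGenerated_powSucc_of_fourfold_typeII_rat hAs hind hA4 N
    · -- quaternion algebra over a real quadratic field, `dim = 2[K:ℚ]`
      obtain ⟨K, _, _, _, _, _, _, hdim⟩ := exists_quaternion_minimal_of_finrank_eq_eight hAs hA4 hde h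
      exact Or.inl fun N => AbelianVariety.isDivisorGenerated_powSucc_of_isSimple_quaternion_of_dim_eq hAs hdim N

/-! ### §3 Consequence: all powers of simple non-commutative fourfolds, modulo Floccari–Fu alone -/

/-- **The Hodge conjecture for ALL POWERS of EVERY simple complex abelian fourfold with non-commutative endomorphism
ring, MODULO FLOCCARI–FU 2026 Thm. 1.2 ALONE** (hypothesis `h5`; the cell's
`hodgeConjectureFor_powSucc_of_simple_noncomm_fourfold` with Moonen–Zarhin's dichotomy discharged by §2).
[cite: FloccariFu2026, Theorem 1.2] [cite: MoonenZarhin1999LowDim, Thm. 0.1 (cases (a)–(d) and part (4))] -/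
theorem hodgeConjectureFor_powSucc_of_simple_noncomm_fourfold_of_floccariFu
    (h5 : FloccariFu2026_hodgeClasses_algebraic_powers_discOneWeilFourfold)
    (hA : A.dim = 4) (hs : A.IsSimple) (hnc : ∃ ψ χ : A ⟶ A, ψ ≫ χ ≠ χ ≫ ψ) (N : ℕ) :
    HodgeConjectureFor (A.powSucc N).dim (A.powSucc N).X :=
  hodgeConjectureFor_powSucc_of_simple_noncomm_fourfold h5
    moonenZarhin1999_simpleFourfold_noncommutative_divisorGenerated_or_quaternion_holds hA hs hnc N

/-- **The type III(1) fourfold cell of the cell's atlas modulo Floccari–Fu alone** (`Ring2.Atlas.HodgePowersOfTypeIIIFourfold`).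
[cite: FloccariFu2026, Theorem 1.2] [cite: MoonenZarhin1999LowDim, Thm. 0.1 (cases (a)–(d) and part (4))] -/
theorem hodgePowersOfTypeIIIFourfold_of_floccariFu (h5 : FloccariFu2026_hodgeClasses_algebraic_powers_discOneWeilFourfold) :
    Summit.HodgeConjecture.HodgeConjecture.Ring2.Atlas.HodgePowersOfTypeIIIFourfold :=
  hodgePowersOfTypeIIIFourfold_of_floccariFu_of_moonenZarhin h5
    moonenZarhin1999_simpleFourfold_noncommutative_divisorGenerated_or_quaternion_holds

/-- **Unconditionally: every simple fourfold with non-commutative endomorphism ring is divisor-generated on all powers or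
of SPLIT Weil type `(2, m)`** (the cell's `divisorGenerated_or_exists_isSplitWeilType_of_simple_noncomm_fourfold` with the
dichotomy discharged). [cite: MoonenZarhin1999LowDim, Thm. 0.1] [cite: vanGeemen1994HodgeAV, Lemma 5.2 and 5.4] -/
theorem divisorGenerated_or_exists_isSplitWeilType_of_simple_noncomm_fourfold' (hA : A.dim = 4) (hs : A.IsSimple)
    (hnc : ∃ ψ χ : A ⟶ A, ψ ≫ χ ≠ χ ≫ ψ) :
    (∀ N : ℕ, IsDivisorGenerated (A.powSucc N)) ∨ ∃ (φ' : A ⟶ A) (m : ℕ), IsSplitWeilType A φ' 2 m :=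
  divisorGenerated_or_exists_isSplitWeilType_of_simple_noncomm_fourfold
    moonenZarhin1999_simpleFourfold_noncommutative_divisorGenerated_or_quaternion_holds hA hs hnc

end Summit.HodgeConjecture.Ring2.NoncommutativeFourfoldsFactHolds

end
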